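import Mathlib
import HarnessLib

/-!
# R10 (`positive-circuit-chart`, val-idea-37 g0; director R275; desk #301 (b) prover hand val-lit-p3 g16) — part 1/3:
# POSITIVE CIRCUITS of a subspace cone and CONFORMAL DECOMPOSITION
For a submodule `V ≤ F^ι` over a linearly ordered field, the cone `K = V ∩ F^ι_{≥0}`; a circuit = a nonzero element of `K`
with minimal support.  Proved: the reduction step, conformal decomposition of every cone element into circuits below it
(induction on the support), proportionality of circuits with equal supports, «every support coordinate meets a circuit»,
«orthogonal to all circuits ⇒ orthogonal to V» when `K` contains a strictly positive vector, and «a vector of `V` supported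
inside a circuit's support is a multiple of it».  R275 P3 scope: a TOOL for the proper positive sub-case rung R10 `ConfinedTameLaw` (val-idea-37 `positive-circuit-chart`);
nothing here closes 5906 (`TwoProducts` / `ResidualLawV21` / `PlanarCellBound` remain OPEN); VP ≠ VNP is NOT proved.
-/

set_option linter.dupNamespace false
set_option linter.unusedSectionVars false

namespace Summit.ValiantsHypothesis.ValiantsHypothesis.Theorems.NewtonUnitEquations.TwoProducts.PermutationType.R10

open scoped BigOperators

variable {F : Type*} [Field F] [LinearOrder F] [IsStrictOrderedRing F]
variable {ι : Type*} [Fintype ι] [DecidableEq ι]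

/-- The support of a vector as a finset. [folklore] -/
def fsupp (x : ι → F) : Finset ι := Finset.univ.filter fun i => x i ≠ 0

/-- Membership in the support. [folklore] -/
theorem mem_fsupp (x : ι → F) (i : ι) : i ∈ fsupp x ↔ x i ≠ 0 := by unfold fsupp; simp

/-- The support is empty iff the vector is zero. [folklore] -/
theorem fsupp_eq_empty_iff (x : ι → F) : fsupp x = ∅ ↔ x = 0 := by
  constructor
  · intro h; funext i
    by_contra hi
    have : i ∈ fsupp x := (mem_fsupp x i).2 hi
    rw [h] at this; simp at this
  · intro h; subst h; ext i; simp [mem_fsupp]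

/-- Membership in the cone `K = V ∩ F^ι_{≥0}`. [folklore] -/
def InCone (V : Submodule F (ι → F)) (x : ι → F) : Prop := x ∈ V ∧ ∀ i, 0 ≤ x i

/-- A CIRCUIT of the cone: a nonzero element of `K` whose support is minimal among nonzero elements of `K`. [folklore] -/
def IsCircuit (V : Submodule F (ι → F)) (c : ι → F) : Prop :=
  InCone V c ∧ c ≠ 0 ∧ ∀ y, InCone V y → y ≠ 0 → fsupp y ⊆ fsupp c → fsupp y = fsupp c

variable (V : Submodule F (ι → F))

/-- The cone is closed under nonnegative combinations. [folklore] -/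
theorem inCone_add {x y : ι → F} (hx : InCone V x) (hy : InCone V y) : InCone V (x + y) :=
  ⟨V.add_mem hx.1 hy.1, fun i => by simp only [Pi.add_apply]; exact add_nonneg (hx.2 i) (hy.2 i)⟩

/-- The cone is closed under nonnegative scaling. [folklore] -/
theorem inCone_smul {x : ι → F} (hx : InCone V x) {t : F} (ht : 0 ≤ t) : InCone V (t • x) :=
  ⟨V.smul_mem t hx.1, fun i => by simp only [Pi.smul_apply, smul_eq_mul]; exact mul_nonneg ht (hx.2 i)⟩

/-- Zero lies in the cone. [folklore] -/
theorem inCone_zero : InCone V (0 : ι → F) := ⟨V.zero_mem, fun _ => le_rfl⟩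

/-- **The reduction step.**  For `x ∈ K` and a nonzero `y ∈ K` with `fsupp y ⊆ fsupp x`, the vector `x − t y` with
`t = min_{i ∈ fsupp y} x_i / y_i` lies in `K`, has support strictly inside `fsupp x`, and `t > 0`. [folklore] -/
theorem reduction_step {x y : ι → F} (hx : InCone V x) (hy : InCone V y) (hy0 : y ≠ 0) (hsub : fsupp y ⊆ fsupp x) :
    ∃ t : F, 0 < t ∧ InCone V (x - t • y) ∧ fsupp (x - t • y) ⊂ fsupp x := by
  classical
  have hne : (fsupp y).Nonempty := by
    rw [Finset.nonempty_iff_ne_empty, Ne, fsupp_eq_empty_iff]; exact hy0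
  -- the ratios on the support of y
  obtain ⟨i₀, hi₀, hmin⟩ := Finset.exists_min_image (fsupp y) (fun i => x i / y i) hne
  have hy_pos : ∀ i ∈ fsupp y, 0 < y i := fun i hi => lt_of_le_of_ne (hy.2 i) (Ne.symm ((mem_fsupp y i).1 hi))
  have hx_pos : ∀ i ∈ fsupp y, 0 < x i := fun i hi =>
    lt_of_le_of_ne (hx.2 i) (Ne.symm ((mem_fsupp x i).1 (hsub hi)))
  set t : F := x i₀ / y i₀ with ht
  have htpos : 0 < t := div_pos (hx_pos i₀ hi₀) (hy_pos i₀ hi₀)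
  refine ⟨t, htpos, ⟨V.sub_mem hx.1 (V.smul_mem t hy.1), fun i => ?_⟩, ?_⟩
  · simp only [Pi.sub_apply, Pi.smul_apply, smul_eq_mul, sub_nonneg]
    by_cases hi : i ∈ fsupp y
    · have h1 : t ≤ x i / y i := hmin i hi
      rw [le_div_iff₀ (hy_pos i hi)] at h1; exact h1
    · have : y i = 0 := by rw [mem_fsupp] at hi; push Not at hi; exact hi
      rw [this, mul_zero]; exact hx.2 i
  · rw [Finset.ssubset_iff_subset_ne]
    refine ⟨fun i hi => ?_, fun h => ?_⟩
    · rw [mem_fsupp] at hi ⊢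
      intro hxi
      apply hi
      have hiy : i ∉ fsupp y := fun h => (mem_fsupp x i).1 (hsub h) hxi
      have : y i = 0 := by rw [mem_fsupp] at hiy; push Not at hiy; exact hiy
      simp [hxi, this]
    · have : i₀ ∈ fsupp (x - t • y) := by rw [h]; exact hsub hi₀
      rw [mem_fsupp] at this
      apply this
      simp only [Pi.sub_apply, Pi.smul_apply, smul_eq_mul, ht]
      rw [div_mul_cancel₀ _ (hy_pos i₀ hi₀).ne', sub_self]

/-- **Conformal decomposition into circuits.**  Every element of the cone is a positive combination of circuits supported
inside its support (as a list of (coefficient, circuit) pairs). [folklore] -/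
theorem conformal_decomposition : ∀ (n : ℕ) (x : ι → F), (fsupp x).card ≤ n → InCone V x →
    ∃ l : List (F × (ι → F)), (∀ p ∈ l, 0 < p.1 ∧ IsCircuit V p.2 ∧ fsupp p.2 ⊆ fsupp x) ∧
      x = (l.map fun p => p.1 • p.2).sum := by
  classical
  intro n
  induction n with
  | zero =>
    intro x hx _
    have : x = 0 := (fsupp_eq_empty_iff x).1 (Finset.card_eq_zero.1 (Nat.le_zero.1 hx))
    exact ⟨[], by simp, by simp [this]⟩
  | succ n ih =>
    intro x hcard hx
    by_cases hx0 : x = 0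
    · exact ⟨[], by simp, by simp [hx0]⟩
    by_cases hc : IsCircuit V x
    · refine ⟨[(1, x)], ?_, by simp⟩
      intro p hp; simp only [List.mem_singleton] at hp; subst hp
      exact ⟨one_pos, hc, subset_rfl⟩
    · -- not a circuit: a nonzero cone element with smaller support exists
      have : ∃ y, InCone V y ∧ y ≠ 0 ∧ fsupp y ⊆ fsupp x ∧ fsupp y ≠ fsupp x := by
        unfold IsCircuit at hc; push Not at hc
        obtain ⟨y, hy, hy0, hsub, hne⟩ := hc hx hx0
        exact ⟨y, hy, hy0, hsub, hne⟩
      obtain ⟨y, hy, hy0, hsub, hne⟩ := this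
      have hyss : fsupp y ⊂ fsupp x := Finset.ssubset_iff_subset_ne.2 ⟨hsub, hne⟩
      obtain ⟨t, htpos, hx', hss⟩ := reduction_step V hx hy hy0 hsub
      have hcy : (fsupp y).card ≤ n := Nat.lt_succ_iff.1 ((Finset.card_lt_card hyss).trans_le hcard)
      have hcx' : (fsupp (x - t • y)).card ≤ n := Nat.lt_succ_iff.1 ((Finset.card_lt_card hss).trans_le hcard)
      obtain ⟨ly, hly, hysum⟩ := ih y hcy hy
      obtain ⟨lx, hlx, hxsum⟩ := ih (x - t • y) hcx' hx'
      refine ⟨(ly.map fun p => (t * p.1, p.2)) ++ lx, ?_, ?_⟩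
      · intro p hp
        rw [List.mem_append, List.mem_map] at hp
        rcases hp with ⟨q, hq, rfl⟩ | hp
        · obtain ⟨hq1, hq2, hq3⟩ := hly q hq
          exact ⟨mul_pos htpos hq1, hq2, hq3.trans hsub⟩
        · obtain ⟨hp1, hp2, hp3⟩ := hlx p hp
          exact ⟨hp1, hp2, hp3.trans hss.subset⟩
      · rw [List.map_append, List.sum_append, List.map_map]
        have e1 : ((ly.map fun p => (t * p.1, p.2)).map fun p => p.1 • p.2) = ly.map fun p => t • (p.1 • p.2) := by
          rw [List.map_map]; congr 1; funext p; simp [mul_smul]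
        have e2 : (ly.map fun p => t • (p.1 • p.2)).sum = t • (ly.map fun p => p.1 • p.2).sum := by
          rw [List.smul_sum, List.map_map]; rfl
        rw [show (List.map ((fun p => p.1 • p.2) ∘ fun p => (t * p.1, p.2)) ly) =
            ((ly.map fun p => (t * p.1, p.2)).map fun p => p.1 • p.2) by rw [List.map_map], e1, e2, ← hysum, ← hxsum]
        simp

/-- **Circuits with equal supports are proportional.** [folklore] -/
theorem circuit_unique {c c' : ι → F} (hc : IsCircuit V c) (hc' : IsCircuit V c') (h : fsupp c = fsupp c') :
    ∃ t : F, 0 < t ∧ c = t • c' := by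
  classical
  obtain ⟨t, htpos, hK, hss⟩ := reduction_step V hc.1 hc'.1 hc'.2.1 (h ▸ subset_rfl)
  -- the reduced vector has smaller support, hence is zero by minimality of c
  have hz : c - t • c' = 0 := by
    by_contra hne
    have := hc.2.2 _ hK hne hss.subset
    exact (Finset.ssubset_iff_subset_ne.1 hss).2 this
  exact ⟨t, htpos, by rw [sub_eq_zero] at hz; exact hz⟩

end Summit.ValiantsHypothesis.ValiantsHypothesis.Theorems.NewtonUnitEquations.TwoProducts.PermutationType.R10

namespace Summit.ValiantsHypothesis.ValiantsHypothesis.Theorems.NewtonUnitEquations.TwoProducts.PermutationType.R10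

open scoped BigOperators

variable {F : Type*} [Field F] [LinearOrder F] [IsStrictOrderedRing F]
variable {ι : Type*} [Fintype ι] [DecidableEq ι]
variable (V : Submodule F (ι → F))

/-- A positive combination of vectors that are nonpositive at `i` is nonpositive at `i`. [folklore] -/
theorem sum_apply_nonpos (l : List (F × (ι → F))) (i : ι) (hl : ∀ p ∈ l, 0 < p.1) (hle : ∀ p ∈ l, p.2 i ≤ 0) :
    (l.map fun p => p.1 • p.2).sum i ≤ 0 := by
  induction l with
  | nil => simp
  | cons q l ih =>
    simp only [List.map_cons, List.sum_cons, Pi.add_apply, Pi.smul_apply, smul_eq_mul]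
    have h1 := hl q (by simp)
    have h2 := hle q (by simp)
    have h3 := ih (fun p hp => hl p (List.mem_cons_of_mem _ hp)) (fun p hp => hle p (List.mem_cons_of_mem _ hp))
    nlinarith

/-- A positive combination of cone elements evaluated at a coordinate where it is positive has a term positive there. [folklore] -/
theorem exists_mem_pos_of_sum_pos (l : List (F × (ι → F))) (hl : ∀ p ∈ l, 0 < p.1 ∧ InCone V p.2) (i : ι)
    (h : 0 < (l.map fun p => p.1 • p.2).sum i) : ∃ p ∈ l, 0 < p.2 i := by
  by_contra hcon
  push Not at hcon
  have := sum_apply_nonpos l i (fun p hp => (hl p hp).1) hcon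
  linarith

/-- Every coordinate in the support of a cone element lies in the support of some circuit below it. [folklore] -/
theorem exists_circuit_mem_fsupp {x : ι → F} (hx : InCone V x) {i : ι} (hi : i ∈ fsupp x) :
    ∃ c, IsCircuit V c ∧ fsupp c ⊆ fsupp x ∧ i ∈ fsupp c := by
  classical
  obtain ⟨l, hl, hsum⟩ := conformal_decomposition V (fsupp x).card x le_rfl hx
  have hpos : 0 < x i := lt_of_le_of_ne (hx.2 i) (Ne.symm ((mem_fsupp x i).1 hi))
  rw [hsum] at hpos
  obtain ⟨p, hp, hpi⟩ := exists_mem_pos_of_sum_pos V l (fun p hp => ⟨(hl p hp).1, (hl p hp).2.1.1⟩) i hpos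
  exact ⟨p.2, (hl p hp).2.1, (hl p hp).2.2, (mem_fsupp _ _).2 hpi.ne'⟩

/-- The cone spans the subspace when it contains a strictly positive vector. [folklore] -/
theorem exists_add_smul_inCone {w : ι → F} (hw : InCone V w) (hwpos : ∀ i, 0 < w i) {v : ι → F} (hv : v ∈ V) :
    ∃ t : F, 0 ≤ t ∧ InCone V (v + t • w) := by
  classical
  -- t = max_i |v i| / w i works
  have hne : (Finset.univ : Finset ι).Nonempty ∨ (Finset.univ : Finset ι) = ∅ := by
    rcases (Finset.univ : Finset ι).eq_empty_or_nonempty with h | h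
    · exact Or.inr h
    · exact Or.inl h
  rcases hne with hne | hemp
  · obtain ⟨i₀, -, hmax⟩ := Finset.exists_max_image Finset.univ (fun i => |v i| / w i) hne
    refine ⟨|v i₀| / w i₀, div_nonneg (abs_nonneg _) (hwpos i₀).le, ⟨V.add_mem hv (V.smul_mem _ hw.1), fun i => ?_⟩⟩
    simp only [Pi.add_apply, Pi.smul_apply, smul_eq_mul]
    have h1 : |v i| / w i ≤ |v i₀| / w i₀ := hmax i (Finset.mem_univ i)
    have h2 : |v i| ≤ |v i₀| / w i₀ * w i := by
      rw [div_le_iff₀ (hwpos i)] at h1; exact h1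
    have h3 : -(v i) ≤ |v i| := neg_le_abs _
    linarith
  · refine ⟨0, le_rfl, ⟨by simpa using hv, fun i => ?_⟩⟩
    exfalso; exact absurd (Finset.mem_univ i) (by rw [hemp]; simp)

/-- A vector orthogonal to every circuit is orthogonal to the whole subspace (when the cone contains a strictly positive vector). [folklore] -/
theorem ortho_of_ortho_circuits {w : ι → F} (hw : InCone V w) (hwpos : ∀ i, 0 < w i) (z : ι → F)
    (hz : ∀ c, IsCircuit V c → ∑ i, z i * c i = 0) : ∀ v ∈ V, ∑ i, z i * v i = 0 := by
  classical
  -- first: orthogonal to every cone element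
  have hK : ∀ x, InCone V x → ∑ i, z i * x i = 0 := by
    intro x hx
    obtain ⟨l, hl, hsum⟩ := conformal_decomposition V (fsupp x).card x le_rfl hx
    rw [hsum]
    clear hsum
    induction l with
    | nil => simp
    | cons q l ih =>
      simp only [List.map_cons, List.sum_cons, Pi.add_apply, Pi.smul_apply, smul_eq_mul]
      have hq := hl q (by simp)
      have h1 : ∑ i, z i * q.2 i = 0 := hz q.2 hq.2.1
      have h2 := ih (fun p hp => hl p (by simp [hp]))
      simp only [mul_add, Finset.sum_add_distrib, h2, add_zero]
      calc ∑ i, z i * (q.1 * q.2 i) = q.1 * ∑ i, z i * q.2 i := by rw [Finset.mul_sum]; exact Finset.sum_congr rfl fun i _ => by ring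
        _ = 0 := by rw [h1, mul_zero]
  intro v hv
  obtain ⟨t, ht, hvt⟩ := exists_add_smul_inCone V hw hwpos hv
  have h1 := hK _ hvt
  have h2 := hK _ hw
  simp only [Pi.add_apply, Pi.smul_apply, smul_eq_mul, mul_add, Finset.sum_add_distrib] at h1
  have h3 : ∑ i, z i * (t * w i) = t * ∑ i, z i * w i := by rw [Finset.mul_sum]; exact Finset.sum_congr rfl fun i _ => by ring
  rw [h3, h2, mul_zero, add_zero] at h1
  exact h1

/-- Any vector of the subspace supported inside a circuit's support is a multiple of the circuit. [folklore] -/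
theorem eq_smul_of_fsupp_subset_circuit {c : ι → F} (hc : IsCircuit V c) {y : ι → F} (hy : y ∈ V) (hsub : fsupp y ⊆ fsupp c) :
    ∃ t : F, y = t • c := by
  classical
  by_cases hy0 : y = 0
  · exact ⟨0, by simp [hy0]⟩
  -- c > 0 on its support; pick t so that c - t•y ≥ 0 and vanishes somewhere (sign cases via ±y)
  have hcpos : ∀ i ∈ fsupp c, 0 < c i := fun i hi => lt_of_le_of_ne (hc.1.2 i) (Ne.symm ((mem_fsupp c i).1 hi))
  have hy_out : ∀ i, i ∉ fsupp c → y i = 0 := fun i hi => by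
    by_contra h; exact hi (hsub ((mem_fsupp y i).2 h))
  -- choose the sign so that u has a positive entry
  have key : ∀ u : ι → F, u ∈ V → u ≠ 0 → fsupp u ⊆ fsupp c → (∃ i, 0 < u i) → ∃ t : F, u = t • c := by
    intro u hu hu0 husub hupos
    -- ratios over the positive entries of u
    let P : Finset ι := Finset.univ.filter fun i => 0 < u i
    have hPne : P.Nonempty := by obtain ⟨i, hi⟩ := hupos; exact ⟨i, by simp [P, hi]⟩
    obtain ⟨i₀, hi₀, hmin⟩ := Finset.exists_min_image P (fun i => c i / u i) hPne
    have hi₀P : 0 < u i₀ := by simpa [P] using hi₀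
    have hi₀c : i₀ ∈ fsupp c := husub ((mem_fsupp u i₀).2 hi₀P.ne')
    set t := c i₀ / u i₀ with ht
    have htpos : 0 < t := div_pos (hcpos i₀ hi₀c) hi₀P
    -- v := c - t • u is in the cone with support ⊊ supp c, hence zero
    have hvK : InCone V (c - t • u) := by
      refine ⟨V.sub_mem hc.1.1 (V.smul_mem t hu), fun i => ?_⟩
      simp only [Pi.sub_apply, Pi.smul_apply, smul_eq_mul, sub_nonneg]
      by_cases hui : 0 < u i
      · have h1 : t ≤ c i / u i := hmin i (by simp [P, hui])
        rw [le_div_iff₀ hui] at h1; exact h1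
      · push Not at hui
        have : t * u i ≤ 0 := mul_nonpos_of_nonneg_of_nonpos htpos.le hui
        linarith [hc.1.2 i]
    have hvsub : fsupp (c - t • u) ⊆ fsupp c := by
      intro i hi
      by_contra hci
      have hci0 : c i = 0 := by rw [mem_fsupp] at hci; push Not at hci; exact hci
      have hui0 : u i = 0 := by
        by_contra h; exact hci (husub ((mem_fsupp u i).2 h))
      rw [mem_fsupp] at hi; apply hi; simp [hci0, hui0]
    have hvne : fsupp (c - t • u) ≠ fsupp c := by
      intro h
      have : i₀ ∈ fsupp (c - t • u) := by rw [h]; exact hi₀c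
      rw [mem_fsupp] at this
      apply this
      simp only [Pi.sub_apply, Pi.smul_apply, smul_eq_mul, ht]
      rw [div_mul_cancel₀ _ hi₀P.ne', sub_self]
    have hz : c - t • u = 0 := by
      by_contra hne
      exact hvne (hc.2.2 _ hvK hne hvsub)
    refine ⟨t⁻¹, ?_⟩
    have : t • u = c := by rw [sub_eq_zero] at hz; exact hz.symm
    rw [← this, smul_smul, inv_mul_cancel₀ htpos.ne', one_smul]
  by_cases hpos : ∃ i, 0 < y i
  · exact key y hy hy0 hsub hpos
  · -- all entries ≤ 0: apply to -y
    push Not at hpos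
    have hneg : ∃ i, 0 < (-y) i := by
      have : ∃ i, y i ≠ 0 := by
        by_contra h; push Not at h; exact hy0 (funext h)
      obtain ⟨i, hi⟩ := this
      exact ⟨i, by simp only [Pi.neg_apply]; have := hpos i; exact neg_pos.mpr (lt_of_le_of_ne this hi)⟩
    have hnsub : fsupp (-y) ⊆ fsupp c := by
      intro i hi; rw [mem_fsupp] at hi; apply hsub; rw [mem_fsupp]; simpa using hi
    obtain ⟨t, ht⟩ := key (-y) (V.neg_mem hy) (neg_ne_zero.mpr hy0) hnsub hneg
    refine ⟨-t, ?_⟩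
    rw [neg_smul, ← ht, neg_neg]

end Summit.ValiantsHypothesis.ValiantsHypothesis.Theorems.NewtonUnitEquations.TwoProducts.PermutationType.R10


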